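import Summits.ResolutionOfSingularities.ResolutionOfSingularities.Theorems.EquisingularLiftEquisingularLiftNatInvStepSingular
import HarnessLib

/-!
# [OURS · L1 W4.5(b) · EL♮(3)] HSUB′(ReachTower₂) inner chain — EXACTNESS OF THE CONE ALONE along the CENTRED in-carrier point step
# (the K-alone form of res-L1-w45b-stub-1's `comap_strictTransformIdeal_carrierPair_eq_sup_of_conePack`, p543070; input of (C)KC)
# (crux `EquisingularLiftNatThree` = stmt-ResolutionOfSingularities-20148, parent `EquisingularLiftNat` = stmt-…-20038)

HONEST FRAMING. OURS (cell res-hironaka, crux chain w45b, slot W4.5(b)); NOT a statement of any manuscript; AI-written, weaker than expert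
review. Helper `--supports stmt-ResolutionOfSingularities-20148 --as helper`; closes nothing; no `sorry`; standard axioms; DEF-FREE.
res-L1-w45b-stub-4 for the `…KC` twin of res-L1-w45b-stub-1's brick (C) (res-D-pv-029 g8 (S2) / board 19:10:33Z «(C)KC open»): stub-1's proof
with ONE cone pack (029: «your `eK` … IS (vii)′ before the `comap_sup`»). Credit: res-L1-w45b-stub-1 (…NatInvStepSingular).

* `comap_strictTransformIdeal_cone_eq_of_conePack` — `(St_τ K)·𝒪_{F₂} = St_υ (K·𝒪_{F₁})` for the centred package's cone.

References: U. Görtz, T. Wedhorn (2020), Prop. 13.91; H. Matsumura (1986), Thm. 14.2, §16 — through the cited tree files.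
-/

set_option linter.dupNamespace false -- mandated namespace `Summit.<Summit>.<Problem>` of this single-conjunct summit
set_option linter.overlappingInstances false -- signatures carry `[IsDomain O] [IsDiscreteValuationRing O]`

noncomputable section

open CategoryTheory CategoryTheory.Limits AlgebraicGeometry TopologicalSpace Topology IsLocalRing
open Literature.AlgebraicGeometry.Resolution
open AlgebraicGeometry.Scheme.IdealSheafData
open Summit.ResolutionOfSingularities.ResolutionOfSingularities.Theses.EquisingularLift.Split
open Summit.ResolutionOfSingularities.ResolutionOfSingularities.Cruxes.EquisingularLift.StrataSplit
open scoped nonZeroDivisors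

namespace Summit.ResolutionOfSingularities.ResolutionOfSingularities.Cruxes.EquisingularLiftNat.Sections

/-- **Exactness of the cone ALONE along the centred step** (K-alone form of stub-1's `comap_strictTransformIdeal_carrierPair_eq_sup_of_conePack`).
[cite: GortzWedhorn2020, Prop. 13.91] [cite: Matsumura1987, Thm. 14.2] [OURS · L1 W4.5b] toward `stub_elnat_coneTowerPointResolution`
(stmt-ResolutionOfSingularities-20148); NOT a statement of the manuscript. -/
theorem comap_strictTransformIdeal_cone_eq_of_conePack (O : Type) [CommRing O] [IsDomain O]
    [IsDiscreteValuationRing O] (k : Type) [Field k] (θ : O →+* k) (hθ : Function.Surjective θ)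
    {X' X₁ F₁ F₂ : Scheme.{0}} (r' : X' ⟶ Spec (.of O)) [IsLocallyNoetherian X₁] [IsLocallyNoetherian F₂] [IsIntegral F₁]
    [IsIntegral F₂] [IsLocallyNoetherian F₁] (j : F₁ ⟶ X') (t : F₁ ⟶ Spec (.of k))
    (hsq : IsPullback j t r' (Spec.map (CommRingCat.ofHom θ))) (J : X'.IdealSheafData)
    (τ : X₁ ⟶ X') (hτ : IsBlowup τ J) (υ : F₂ ⟶ F₁) (j₂ : F₂ ⟶ X₁) (hcomm : j₂ ≫ τ = υ ≫ j)
    (x : F₁) (hx : IsClosed ({x} : Set F₁)) (hυ : IsBlowup υ (vanishingIdeal ⟨{x}, hx⟩))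
    (hJ : J.comap j = vanishingIdeal ⟨{x}, hx⟩) (ϖ : O) (hϖ : Irreducible ϖ)
    {r : ℕ} (c : Fin (r + 1) → X'.presheaf.stalk (j x)) (hcJ : Ideal.span (Set.range c) = stalkIdeal J (j x))
    (hc : IsQuasiRegular c) [IsDomain (X'.presheaf.stalk (j x) ⧸ Ideal.span (Set.range c))]
    (hcb : IsQuasiRegular fun l : Fin r => Ideal.Quotient.mk (Ideal.span {c 0}) (c l.succ))
    (hϖc : (X'.presheaf.Γgerm (j x)).hom (r'.appTop.hom ((Scheme.ΓSpecIso (.of O)).inv.hom ϖ)) ∉ Ideal.span (Set.range c))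
    (h𝔪 : Ideal.span (Set.range c) ⊔
      Ideal.span {(X'.presheaf.Γgerm (j x)).hom (r'.appTop.hom ((Scheme.ΓSpecIso (.of O)).inv.hom ϖ))} =
        maximalIdeal (X'.presheaf.stalk (j x)))
    (𝓢 K : X'.IdealSheafData) (h𝓢 : stalkIdeal 𝓢 (j x) = Ideal.span {c 0})
    {d : ℕ} (Φ : MvPolynomial (Fin r) (X'.presheaf.stalk (j x))) (hΦd : Φ.IsHomogeneous d)
    (hK : stalkIdeal K (j x) = Ideal.span {MvPolynomial.eval (fun l => c l.succ) Φ})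
    (hΦ : MvPolynomial.map (Ideal.Quotient.mk (Ideal.span (Set.range c))) Φ ≠ 0)
    (hΦ𝔪 : MvPolynomial.map (residue (X'.presheaf.stalk (j x))) Φ ≠ 0) :
    (strictTransformIdeal τ J K).comap j₂ = strictTransformIdeal υ (vanishingIdeal ⟨{x}, hx⟩) (K.comap j) := by
  classical
  obtain ⟨hc𝔪d, hcq, -, -, -, hΦbar, -⟩ :=
    conePack_stalkMap_of_model O k θ hθ r' j t hsq x ϖ hϖ c hc hcb hϖc h𝔪 𝓢 K h𝓢 Φ hΦd hK hΦ𝔪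
  haveI : Nontrivial (F₁.presheaf.stalk x ⧸ Ideal.span (Set.range fun i => (j.stalkMap x).hom (c i))) := by
    rw [hc𝔪d]; exact Ideal.Quotient.nontrivial_iff.mpr (maximalIdeal.isMaximal _).ne_top
  -- renaming a form in the tail variables to the frame variables keeps it non-zero
  have hren : ∀ {R : Type} [CommRing R] (ψ : MvPolynomial (Fin r) R), ψ ≠ 0 → MvPolynomial.rename Fin.succ ψ ≠ 0 :=
    fun ψ hψ h => hψ (MvPolynomial.rename_injective _ (Fin.succ_injective _) (by rw [h, map_zero]))
  -- `K`: the form `Φ` renamed to the frame variables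
  exact comap_strictTransformIdeal_eq_of_model τ J K hτ j υ j₂ hcomm x hx hυ hJ c hcJ hc
    (MvPolynomial.rename Fin.succ Φ) hΦd.rename_isHomogeneous (by rw [MvPolynomial.map_rename]; exact hren _ hΦ)
    (by rw [MvPolynomial.eval_rename]; exact hK) hcq
    (by rw [MvPolynomial.map_rename, MvPolynomial.map_rename]; exact hren _ hΦbar)

end Summit.ResolutionOfSingularities.ResolutionOfSingularities.Cruxes.EquisingularLiftNat.Sections

end
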